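import Literature.Geometry.Lorentzian.LeviCivita
import Literature.Geometry.Lorentzian.CurvatureSymmetries
import Literature.Geometry.Lorentzian.LeviCivitaProofs
import HarnessLib

/-!
# Translational Killing initial data: the Lorentzian pairing of two solutions is constant

Beig–Chruściel, J. Math. Phys. 37 (1996), proof of Thm. 4.1 (the rigid positive energy theorem;
named fact `Literature.Geometry.Lorentzian.positive_mass_rigidity_spacetime` of
`SpacetimePositiveMassRigidity.lean`) and App. A, (A.11)–(A.11.0): a spinor which is parallel for
the Sen connection of the data `(Σ, g, K)` yields a function `N` and a vector field `Y` solving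
the linear first-order system

  `DᵢYⱼ + N Kᵢⱼ = 0`,  `DᵢN + KᵢⱼYʲ = 0`                                                   (∗)

— the restriction to `Σ` of a space-time vector field `N n + Y` *parallel* along `Σ`
("translational", or parallel, Killing initial data; a special case of the KID equations of
Moncrief 1975 / Beig–Chruściel 1997, §2). The proof of Thm. 4.1 then uses that for such pairs
the Lorentzian pairing `−N N' + g(Y, Y')` is constant — there in the form
`ĝ(X, X) = −1 ⟹ N² − gᵢⱼYⁱYʲ = 1` for the covariantly constant field `X = ∂ᵤ` of the Killing
development — and, for the four solutions with null asymptotic values, that their Gram matrix is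
the Minkowski metric. This file proves the initial-data form of that conservation law, for a
`C¹` pseudo-Riemannian metric of any signature on any manifold and an arbitrary tensor `k`
(theorems only; no definition, no named fact):

* `PseudoRiemannianMetric.mvfderiv_kidPairing_eq_zero` — if `(N, Y)` and `(N', Y')` satisfy (∗)
  at `x` in the direction `V x` (for the Levi-Civita connection of `g`), then the derivative of
  `y ↦ g_y(Y_y, Y'_y) − N(y) N'(y)` at `x` in the direction `V x` vanishes. Proof: metric
  compatibility of the Levi-Civita connection (`isLeviCivita_leviCivita_holds`,
  `LeviCivitaProofs`) gives `V g(Y, Y') = g(∇_V Y, Y') + g(Y, ∇_V Y') = −N k(V, Y') − N' k(V, Y)`,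
  and the Leibniz rule gives `V (N N') = −N k(V, Y') − N' k(V, Y)`; no symmetry of `k` is
  needed.
* `PseudoRiemannianMetric.mvfderiv_kidNormSq_eq_zero` — the case `(N', Y') = (N, Y)`:
  `g(Y, Y) − N²` has vanishing derivative along every such direction (B–C's `N² − |Y|² = 1`).

## References

* R. Beig, P. T. Chruściel, *Killing vectors in asymptotically flat space-times. I.*, J. Math.
  Phys. 37 (1996) 1939–1961, arXiv:gr-qc/9510015: §4, proof of Thm. 4.1 (the system (∗) and
  `N² − gᵢⱼYⁱYʲ = 1`), App. A, (A.11)–(A.11.0). [BeigChrusciel1996]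
* V. Moncrief, *Spacetime symmetries and linearization stability of the Einstein equations. I*,
  J. Math. Phys. 16 (1975) 493–498, §III (Killing initial data). [Moncrief1975]
* B. O'Neill, *Semi-Riemannian geometry*, Academic Press 1983, Ch. 3, Thm. 3.11 (D4)
  (metric compatibility). [ONeill1983]
-/

noncomputable section

open Bundle Set NormedSpace
open scoped Manifold ContDiff Topology

namespace Literature.Geometry.Lorentzian

variable {E : Type*} [NormedAddCommGroup E] [NormedSpace ℝ E] {H : Type*} [TopologicalSpace H]
  {I : ModelWithCorners ℝ E H} {M : Type*} [TopologicalSpace M] [ChartedSpace H M]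
  [IsManifold I ∞ M] {n : ℕ∞ω}

namespace PseudoRiemannianMetric

variable (g : PseudoRiemannianMetric I n E (TangentSpace I : M → Type _))
  [Fact (1 ≤ n)] [FiniteDimensional ℝ E] [CompleteSpace E] [g.HasLeviCivita]

/-- **The Lorentzian pairing of two translational Killing initial data is conserved.** Let `g`
be a `C¹` pseudo-Riemannian metric with its Levi-Civita connection `∇`, `k` any field of
bilinear forms, and let `(N, Y)`, `(N', Y')` (functions and vector fields differentiable at `x`)
satisfy at `x`, in the direction of the vector field `V` (differentiable at `x`), the
translational KID system of Beig–Chruściel 1996, App. A, (A.11)–(A.11.0):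
`g(∇_V Y, w) = −N k(V, w)` for all `w` and `dN(V) = −k(V, Y)`, and likewise for `(N', Y')`.
Then `V (g(Y, Y') − N N') = 0` at `x`: the derivative of `y ↦ g_y(Y_y, Y'_y) − N(y) N'(y)` at
`x` applied to `V x` vanishes (metric compatibility `V g(Y,Y') = g(∇_V Y, Y') + g(Y, ∇_V Y')`,
O'Neill 1983, Thm. 3.11 (D4), and the Leibniz rule; both sides equal
`−N k(V, Y') − N' k(V, Y)`). This is the initial-data form of "`X` covariantly constant ⟹
`ĝ(X, X')` constant" used in the proof of Beig–Chruściel, J. Math. Phys. 37 (1996), Thm. 4.1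
(§4: `ĝ(X, X) = −1 ⟹ N² − gᵢⱼYⁱYʲ = 1`).
[cite: BeigChrusciel1996, §4 (proof of Thm. 4.1) and App. A (A.11)–(A.11.0)] -/
theorem mvfderiv_kidPairing_eq_zero
    (k : Π x : M, TangentSpace I x →L[ℝ] TangentSpace I x →L[ℝ] ℝ) {x : M}
    {V Y Y' : Π x : M, TangentSpace I x} {N N' : M → ℝ}
    (hV : MDiffAt (T% V) x) (hY : MDiffAt (T% Y) x) (hY' : MDiffAt (T% Y') x)
    (hN : MDiffAt N x) (hN' : MDiffAt N' x)
    (hDY : ∀ w, g.val x (g.leviCivita Y x (V x)) w = -(N x * k x (V x) w))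
    (hDY' : ∀ w, g.val x (g.leviCivita Y' x (V x)) w = -(N' x * k x (V x) w))
    (hdN : mvfderiv I N x (V x) = -(k x (V x) (Y x)))
    (hdN' : mvfderiv I N' x (V x) = -(k x (V x) (Y' x))) :
    mvfderiv I (fun y ↦ g.val y (Y y) (Y' y) - N y * N' y) x (V x) = 0 := by
  have hcompat : g.IsCompatible g.leviCivita := (isLeviCivita_leviCivita_holds (g := g)).2
  have hA : MDiffAt (fun y ↦ g.val y (Y y) (Y' y)) x := g.mdifferentiableAt_val_apply hY hY'
  have hB : MDiffAt (fun y ↦ N y * N' y) x := hN.mul hN'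
  -- derivative of the metric pairing: compatibility
  have h1 : mvfderiv I (fun y ↦ g.val y (Y y) (Y' y)) x (V x) =
      -(N x * k x (V x) (Y' x)) - N' x * k x (V x) (Y x) := by
    rw [hcompat hV hY hY', hDY (Y' x), g.symm x (Y x), hDY' (Y x)]
    ring
  -- derivative of the product of the lapses: Leibniz
  have h2 : mvfderiv I (fun y ↦ N y * N' y) x (V x) =
      -(N x * k x (V x) (Y' x)) - N' x * k x (V x) (Y x) := by
    rw [mvfderiv_fun_mul hN hN', add_apply, smul_apply,
      smul_apply, hdN, hdN', smul_eq_mul, smul_eq_mul]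
    ring
  rw [mvfderiv_fun_sub hA hB, sub_apply, h1, h2, sub_self]

/-- **The Lorentzian norm of translational Killing initial data is conserved**: the case
`(N', Y') = (N, Y)` of `mvfderiv_kidPairing_eq_zero` — if `g(∇_V Y, w) = −N k(V, w)` for all `w`
and `dN(V) = −k(V, Y)` at `x`, then `V (g(Y, Y) − N²) = 0` at `x`. For the timelike combination
of the proof of Beig–Chruściel, J. Math. Phys. 37 (1996), Thm. 4.1 (§4) this is
`N² − gᵢⱼYⁱYʲ ≡ 1` (given the asymptotic values `N → 1`, `Y → 0` and connectedness).
[cite: BeigChrusciel1996, §4 (proof of Thm. 4.1) and App. A (A.11)–(A.11.0)] -/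
theorem mvfderiv_kidNormSq_eq_zero
    (k : Π x : M, TangentSpace I x →L[ℝ] TangentSpace I x →L[ℝ] ℝ) {x : M}
    {V Y : Π x : M, TangentSpace I x} {N : M → ℝ}
    (hV : MDiffAt (T% V) x) (hY : MDiffAt (T% Y) x) (hN : MDiffAt N x)
    (hDY : ∀ w, g.val x (g.leviCivita Y x (V x)) w = -(N x * k x (V x) w))
    (hdN : mvfderiv I N x (V x) = -(k x (V x) (Y x))) :
    mvfderiv I (fun y ↦ g.val y (Y y) (Y y) - N y * N y) x (V x) = 0 :=
  g.mvfderiv_kidPairing_eq_zero k hV hY hY hN hN hDY hDY hdN hdN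

end PseudoRiemannianMetric

end Literature.Geometry.Lorentzian

end
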